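import Summits.CriticalPhenomena.SAWScalingLimit.Theorems.SAWLoopFugacityFlowAvoidancePassageBites
import Literature.Topology.PlaneTopology.HalfDiscCrosscut
import Literature.Topology.PlaneTopology.AnnulusFaces

/-!
# Half-disc charts of bites and carving one bite off a Jordan domain

Support file for item `stmt-CriticalPhenomena-4984` (`AvoidancePassage`).

* `exists_halfDisc_chart` — **chart of a Jordan domain by the upper half-disc**: for a Jordan
  domain `B` there is a homeomorphism `h : ℂ ≃ₜ ℂ` with `h(𝔻 ∩ ℍ) = B` and
  `h (M.boundary t) = B.boundary t` for the half-disc `M = halfDisc 1` (diameter on `[0, ½]`,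
  semicircle on `[½, 1]`): the Schoenflies theorem of the tree
  (`JordanDomain.exists_homeomorph_eqOn_frontier`) applied to the boundary transfer
  `loopTransfer`. For a bite whose loop runs through the shadow `s ⊆ ∂D` on `[0, ½]`, the
  diameter goes onto `s` (`chart_ofReal`).
* `exists_lt_one_subset_image` — a compact subset of `B` lies in the image of a smaller half-disc.
* `exists_carve` — **carving**: if `B ⊆ Ω ⊆ D` (Jordan domains) and `h` maps the open diameter
  into `∂D`, then for `0 < ρ < 1` the set `Ω ∖ h(closed half-disc of radius ρ)` is again (the
  carrier of) a Jordan domain — Newman's theorem for the cross-cut `h(semicircle of radius ρ)` of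
  `Ω` (`exists_jordan_sides`).

All folklore; no new definitions.
-/

noncomputable section

namespace Summit.CriticalPhenomena.SAWScalingLimit.Theorems.AvoidancePassage

open Set Metric Filter Topology Complex
open UpperHalfPlane (upperHalfPlaneSet isOpen_upperHalfPlaneSet)
open Literature.Topology.PlaneTopology
open Literature.Probability.RandomPlanarGeometry (JordanDomain)

/-! ### The half-disc chart of a Jordan domain -/

/-- **Half-disc chart.** Every Jordan domain `B` is `h(𝔻 ∩ ℍ)` for a homeomorphism `h` of `ℂ`
transporting the boundary loop of `halfDisc 1` to that of `B` parameter-wise.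
[cite: PommerenkeBBCM1992, §2.3 Cor. 2.9 (p. 25)] -/
theorem exists_halfDisc_chart (B : JordanDomain) :
    ∃ h : ℂ ≃ₜ ℂ, (∀ t : ℝ, h ((halfDisc 1 one_pos).boundary t) = B.boundary t) ∧
      h '' (ball 0 1 ∩ upperHalfPlaneSet) = B.carrier := by
  set M := halfDisc 1 one_pos with hM
  set φ := loopTransfer M.boundary B.boundary with hφ
  have hφc : ContinuousOn φ (frontier M.carrier) := by
    rw [← M.range_boundary]
    exact continuousOn_loopTransfer M.continuous_boundary M.periodic_boundary M.injOn_boundary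
      B.continuous_boundary B.periodic_boundary
  have hφb : BijOn φ (frontier M.carrier) (frontier B.carrier) := by
    rw [← M.range_boundary, ← B.range_boundary]
    exact bijOn_loopTransfer M.periodic_boundary M.injOn_boundary B.periodic_boundary
      B.injOn_boundary
  obtain ⟨h, heq, hcar, -, -⟩ := JordanDomain.exists_homeomorph_eqOn_frontier M B hφc hφb
  refine ⟨h, fun t ↦ ?_, hcar⟩
  rw [heq (M.boundary_mem_frontier t)]
  exact loopTransfer_apply M.periodic_boundary M.injOn_boundary B.periodic_boundary t

/-- The chart on the diameter: `h x = B.boundary ((x + 1)/4)` for `|x| ≤ 1`. [folklore] -/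
theorem chart_ofReal {B : JordanDomain} {h : ℂ ≃ₜ ℂ}
    (hh : ∀ t : ℝ, h ((halfDisc 1 one_pos).boundary t) = B.boundary t) {x : ℝ} (hx : |x| ≤ 1) :
    h x = B.boundary ((x + 1) / 4) := by
  rw [abs_le] at hx
  have h1 : (halfDisc 1 one_pos).boundary ((x + 1) / 4) = x := by
    rw [halfDisc_boundary_of_le_half one_pos (by linarith) (by linarith)]
    push_cast
    ring
  rw [← h1, hh]

/-- **The open diameter goes into the open shadow.** If the loop of `B` runs through `s` on
`[0, ½]`, then for `|x| < 1` the point `h x` lies on `s` and differs from the two end-points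
`B.boundary 0`, `B.boundary ½`. [folklore] -/
theorem chart_ofReal_mem {B : JordanDomain} {h : ℂ ≃ₜ ℂ}
    (hh : ∀ t : ℝ, h ((halfDisc 1 one_pos).boundary t) = B.boundary t) {x : ℝ} (hx : |x| < 1) :
    h x ∈ B.boundary '' Icc 0 (1 / 2) ∧ h x ≠ B.boundary 0 ∧ h x ≠ B.boundary (1 / 2) := by
  rw [chart_ofReal hh hx.le]
  rw [abs_lt] at hx
  have hmem : (x + 1) / 4 ∈ Ico (0 : ℝ) 1 := ⟨by linarith, by linarith⟩
  refine ⟨⟨(x + 1) / 4, ⟨by linarith, by linarith⟩, rfl⟩, fun h0 ↦ ?_, fun h1 ↦ ?_⟩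
  · have := B.injOn_boundary hmem ⟨le_rfl, one_pos⟩ h0
    linarith
  · have := B.injOn_boundary hmem ⟨by norm_num, by norm_num⟩ h1
    linarith

/-- Points of the closed upper half-plane of modulus `< 1` with positive imaginary part are
charted into `B`. [folklore] -/
theorem chart_mem_carrier {B : JordanDomain} {h : ℂ ≃ₜ ℂ}
    (hhB : h '' (ball 0 1 ∩ upperHalfPlaneSet) = B.carrier) {w : ℂ} (hw : ‖w‖ < 1) (him : 0 < w.im) :
    h w ∈ B.carrier := by
  rw [← hhB]
  exact mem_image_of_mem h ⟨by rwa [mem_ball, dist_zero_right], him⟩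

/-- **A compact subset of `B` lies in the image of a smaller half-disc.** [folklore] -/
theorem exists_lt_one_subset_image {B : JordanDomain} {h : ℂ ≃ₜ ℂ}
    (hhB : h '' (ball 0 1 ∩ upperHalfPlaneSet) = B.carrier) {K : Set ℂ} (hK : IsCompact K)
    (hKB : K ⊆ B.carrier) :
    ∃ ρ : ℝ, 0 < ρ ∧ ρ < 1 ∧ K ⊆ h '' (ball 0 ρ ∩ upperHalfPlaneSet) := by
  set P := h.symm '' K with hP
  have hPc : IsCompact P := hK.image h.symm.continuous
  have hPsub : P ⊆ ball 0 1 ∩ upperHalfPlaneSet := by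
    rintro _ ⟨z, hz, rfl⟩
    have hz' : z ∈ h '' (ball 0 1 ∩ upperHalfPlaneSet) := hhB ▸ hKB hz
    obtain ⟨w, hw, rfl⟩ := hz'
    rwa [h.symm_apply_apply]
  rcases P.eq_empty_or_nonempty with hPe | hPne
  · refine ⟨1 / 2, by norm_num, by norm_num, ?_⟩
    have hKe : K = ∅ := by
      rw [hP, image_eq_empty] at hPe
      exact hPe
    rw [hKe]
    exact empty_subset _
  obtain ⟨w₀, hw₀, hmax⟩ := hPc.exists_isMaxOn hPne continuous_norm.continuousOn
  have hw₀1 : ‖w₀‖ < 1 := by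
    have := (hPsub hw₀).1
    rwa [mem_ball, dist_zero_right] at this
  refine ⟨(‖w₀‖ + 1) / 2, by positivity, by linarith, fun z hz ↦ ?_⟩
  have hzP : h.symm z ∈ P := mem_image_of_mem _ hz
  refine ⟨h.symm z, ⟨?_, (hPsub hzP).2⟩, h.apply_symm_apply z⟩
  rw [mem_ball, dist_zero_right]
  have hle : ‖h.symm z‖ ≤ ‖w₀‖ := hmax hzP
  linarith

/-! ### Carving one bite -/

/-- The closed upper semicircle of radius `ρ > 0` is a simple arc from `ρ` to `-ρ`. [folklore] -/
theorem isSimpleArc_semicircle {ρ : ℝ} (hρ : 0 < ρ) :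
    IsSimpleArc {z : ℂ | ‖z‖ = ρ ∧ 0 ≤ z.im} (ρ : ℂ) (-(ρ : ℂ)) := by
  rw [← range_upperArc hρ]
  refine ⟨(upperArc ρ).extend, (upperArc ρ).continuous_extend.continuousOn, ?_,
    (upperArc ρ).image_extend_of_subset Subset.rfl, (upperArc ρ).extend_zero,
    (upperArc ρ).extend_one⟩
  intro s hs t ht hst
  rw [Path.extend_apply _ hs, Path.extend_apply _ ht] at hst
  exact congrArg Subtype.val (injective_upperArc hρ hst)

/-- A complex number with zero imaginary part is its real part. [folklore] -/
theorem eq_ofReal_re_of_im_eq_zero {w : ℂ} (hw : w.im = 0) : w = (w.re : ℂ) :=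
  Complex.ext (by simp) (by simp [hw])

/-- **Carving a bite.** Let `B ⊆ Ω ⊆ D` be Jordan domains, `h` a homeomorphism of `ℂ` with
`h(𝔻 ∩ ℍ) = B` mapping the open diameter `(-1, 1)` into `∂D`. Then for `0 < ρ < 1` the open set
`Ω ∖ h(closed upper half-disc of radius ρ)` is the carrier of a Jordan domain: the image of the
semicircle of radius `ρ` is a cross-cut of `Ω`, one of whose sides (Newman) is the image of the
open half-disc of radius `ρ` and the other the carved domain.
[cite: Newman1939, Ch. V §11, Thms. 11·7 and 11·8, pp. 94–95] -/
theorem exists_carve (D Ω B : JordanDomain) (h : ℂ ≃ₜ ℂ) {ρ : ℝ} (hρ0 : 0 < ρ) (hρ1 : ρ < 1)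
    (hΩD : Ω.carrier ⊆ D.carrier) (hBΩ : B.carrier ⊆ Ω.carrier)
    (hhB : h '' (ball 0 1 ∩ upperHalfPlaneSet) = B.carrier)
    (hdiam : ∀ x : ℝ, |x| < 1 → h x ∈ frontier D.carrier) :
    ∃ J : JordanDomain, J.carrier = Ω.carrier \ h '' (closedBall 0 ρ ∩ {z : ℂ | 0 ≤ z.im}) := by
  set G : Set ℂ := ball 0 ρ ∩ upperHalfPlaneSet with hG
  set S : Set ℂ := {z : ℂ | ‖z‖ = ρ ∧ 0 ≤ z.im} with hS
  set K : Set ℂ := closedBall 0 ρ ∩ {z : ℂ | 0 ≤ z.im} with hK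
  set V : Set ℂ := h '' G with hV
  set L : Set ℂ := h '' S with hL_def
  have hKcl : closure G = K := closure_ball_inter_upperHalfPlaneSet hρ0
  have hclV : closure V = h '' K := by rw [← hKcl, h.image_closure]
  -- real points of `K` are charted into `∂D`
  have hreal : ∀ w : ℂ, w.im = 0 → |w.re| ≤ ρ → h w ∈ frontier D.carrier := fun w hw hre ↦ by
    rw [eq_ofReal_re_of_im_eq_zero hw]
    exact hdiam w.re (lt_of_le_of_lt hre hρ1)
  have hG1 : ∀ w : ℂ, ‖w‖ ≤ ρ → 0 < w.im → h w ∈ B.carrier := fun w hw him ↦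
    chart_mem_carrier hhB (lt_of_le_of_lt hw hρ1) him
  -- the cross-cut `L`
  have hL : IsSimpleArc L (h ρ) (h (-(ρ : ℂ))) :=
    (isSimpleArc_semicircle hρ0).image h.continuous h.injective
  have hends : ∀ w ∈ S, h w ≠ h ρ → h w ≠ h (-(ρ : ℂ)) → 0 < w.im := by
    rintro w ⟨hwn, hwim⟩ h1 h2
    rcases hwim.lt_or_eq with hlt | heq
    · exact hlt
    · exfalso
      have hw : w = (w.re : ℂ) := eq_ofReal_re_of_im_eq_zero heq.symm
      have hre : |w.re| = ρ := by
        rw [hw, Complex.norm_real, Real.norm_eq_abs] at hwn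
        exact hwn
      rcases (abs_eq hρ0.le).1 hre with hr | hr
      · exact h1 (by rw [hw, hr])
      · exact h2 (by rw [hw, hr]; push_cast; rfl)
  have hLΩ : L \ {h ρ, h (-(ρ : ℂ))} ⊆ Ω.carrier := by
    rintro _ ⟨⟨w, hw, rfl⟩, hne⟩
    simp only [mem_insert_iff, mem_singleton_iff, not_or] at hne
    exact hBΩ (hG1 w hw.1.le (hends w hw hne.1 hne.2))
  have hfrΩ : ∀ x : ℝ, |x| ≤ ρ → h x ∈ frontier Ω.carrier := by
    intro x hx
    rw [Ω.isOpen.frontier_eq]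
    refine ⟨?_, fun hxΩ ↦ Set.disjoint_left.1 D.disjoint_carrier_frontier (hΩD hxΩ)
      (hdiam x (lt_of_le_of_lt hx hρ1))⟩
    have hxK1 : (x : ℂ) ∈ closure (ball (0 : ℂ) 1 ∩ upperHalfPlaneSet) := by
      rw [closure_ball_inter_upperHalfPlaneSet one_pos]
      refine ⟨?_, by simp⟩
      rw [mem_closedBall, dist_zero_right, Complex.norm_real, Real.norm_eq_abs]
      linarith
    have : h x ∈ closure B.carrier := by
      rw [← hhB, ← h.image_closure]
      exact mem_image_of_mem h hxK1
    exact closure_mono hBΩ this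
  have ha : h ρ ∈ frontier Ω.carrier := hfrΩ ρ (by rw [abs_of_pos hρ0])
  have hb : h (-(ρ : ℂ)) ∈ frontier Ω.carrier := by
    have := hfrΩ (-ρ) (by rw [abs_neg, abs_of_pos hρ0])
    push_cast at this
    exact this
  obtain ⟨J₁, J₂, A₁, A₂, hdisj, hunion, -⟩ := exists_jordan_sides Ω hL ha hb hLΩ
  -- `V` is connected, lies in `Ω ∖ L`, and `closure V ∩ Ω ⊆ V ∪ L`
  have hVΩ : V ⊆ Ω.carrier := by
    rintro _ ⟨w, hw, rfl⟩
    have h1 : ‖w‖ < ρ := by have := hw.1; rwa [mem_ball, dist_zero_right] at this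
    exact hBΩ (hG1 w h1.le hw.2)
  have hVL : Disjoint V L := by
    rw [Set.disjoint_iff]
    rintro _ ⟨⟨w, hw, rfl⟩, ⟨w', hw', heq⟩⟩
    have hww : w' = w := h.injective heq
    rw [hww] at hw'
    have h1 : ‖w‖ < ρ := by have := hw.1; rwa [mem_ball, dist_zero_right] at this
    exact absurd hw'.1 h1.ne
  have hVconn : IsPreconnected V :=
    ((convex_ball (0 : ℂ) ρ).inter (convex_halfSpace_im_gt 0)).isPreconnected.image _
      h.continuous.continuousOn
  have hclVΩ : ∀ z ∈ closure V, z ∈ Ω.carrier → z ∈ V ∨ z ∈ L := by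
    intro z hz hzΩ
    rw [hclV] at hz
    obtain ⟨w, ⟨hwn, hwim⟩, rfl⟩ := hz
    rw [mem_closedBall, dist_zero_right] at hwn
    have hwim' : 0 ≤ w.im := hwim
    rcases hwim'.lt_or_eq with hpos | hzero
    · rcases hwn.lt_or_eq with hlt | heq
      · exact Or.inl ⟨w, ⟨by rwa [mem_ball, dist_zero_right], hpos⟩, rfl⟩
      · exact Or.inr ⟨w, ⟨heq, hwim'⟩, rfl⟩
    · exfalso
      have hre : |w.re| ≤ ρ := (abs_re_le_norm w).trans hwn
      exact Set.disjoint_left.1 D.disjoint_carrier_frontier (hΩD hzΩ) (hreal w hzero.symm hre)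
  have hVsub : V ⊆ Ω.carrier \ L := fun z hz ↦ ⟨hVΩ hz, fun hzL ↦ Set.disjoint_left.1 hVL hz hzL⟩
  have hLK : L ⊆ h '' K := by
    rintro _ ⟨w, hw, rfl⟩
    exact ⟨w, ⟨by rw [mem_closedBall, dist_zero_right]; exact hw.1.le, hw.2⟩, rfl⟩
  have hVne : V.Nonempty := by
    refine ⟨h (((ρ / 2 : ℝ) : ℂ) * I), ((ρ / 2 : ℝ) : ℂ) * I, ⟨?_, ?_⟩, rfl⟩
    · rw [mem_ball, dist_zero_right, norm_mul, Complex.norm_real, Complex.norm_I, mul_one,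
        Real.norm_eq_abs, abs_of_pos (by positivity)]
      linarith
    · show 0 < ((((ρ / 2 : ℝ) : ℂ)) * I).im
      simp [hρ0]
  -- whichever side contains `V` IS `V`; the other side is the carved domain
  have finish : ∀ P Q : JordanDomain, Disjoint P.carrier Q.carrier →
      P.carrier ∪ Q.carrier = Ω.carrier \ L → V ⊆ P.carrier →
      Q.carrier = Ω.carrier \ h '' K := by
    intro P Q hPQ hPQu hVP
    apply Subset.antisymm
    · intro z hz
      have hz' : z ∈ Ω.carrier \ L := hPQu ▸ Or.inr hz
      refine ⟨hz'.1, fun hzK ↦ ?_⟩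
      rw [← hclV] at hzK
      rcases hclVΩ z hzK hz'.1 with hzV | hzL
      · exact Set.disjoint_left.1 hPQ (hVP hzV) hz
      · exact hz'.2 hzL
    · rintro z ⟨hzΩ, hzK⟩
      have hzL : z ∉ L := fun hzL ↦ hzK (hLK hzL)
      have hz' : z ∈ P.carrier ∪ Q.carrier := hPQu ▸ ⟨hzΩ, hzL⟩
      rcases hz' with hzP | hzQ
      · exfalso
        have hPsub : P.carrier ⊆ V ∪ (closure V)ᶜ := by
          intro y hy
          by_cases hyc : y ∈ closure V
          · have hy' : y ∈ Ω.carrier \ L := hPQu ▸ Or.inl hy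
            rcases hclVΩ y hyc hy'.1 with hyV | hyL
            · exact Or.inl hyV
            · exact absurd hyL hy'.2
          · exact Or.inr hyc
        obtain ⟨v, hv⟩ := hVne
        have hVo : IsOpen V := h.isOpenMap _ (isOpen_ball.inter isOpen_upperHalfPlaneSet)
        rcases P.isConnected.isPreconnected.subset_or_subset hVo isClosed_closure.isOpen_compl
          (Set.disjoint_left.2 fun y hy hyc ↦ hyc (subset_closure hy)) hPsub with hPV | hPc
        · exact hzK (by rw [← hclV]; exact subset_closure (hPV hzP))
        · exact hPc (hVP hv) (subset_closure hv)
      · exact hzQ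
  rcases subset_or_subset_of_sides J₁.isOpen J₂.isOpen hdisj hunion hVconn hVsub with hV1 | hV2
  · exact ⟨J₂, finish J₁ J₂ hdisj hunion hV1⟩
  · exact ⟨J₁, finish J₂ J₁ hdisj.symm (by rw [union_comm, hunion]) hV2⟩

end Summit.CriticalPhenomena.SAWScalingLimit.Theorems.AvoidancePassage

end
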